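import Literature.NumberTheory.EllipticCurves.ComplexMultiplicationDeuringGaloisAction
import HarnessLib

/-!
# Deuring's theorem in Galois form at a split prime — proved corollaries

Topic `Literature/NumberTheory/EllipticCurves`; sibling PROOFS file (theorems only: no definition, no named
fact, no instance, no `sorry`) of `ComplexMultiplicationDeuringGaloisAction.lean`, whose named fact
`Deuring_galoisAction_cmPrimaryTorsion_split` (Rubin, LNM 1716, Thm. 5.15 (i)–(ii), Cor. 5.16 (i)–(ii),
Prop. 5.4; Silverman, *Advanced Topics*, II Thm. 9.1–9.2, Prop. 10.4) and predicates
`DeuringGaloisAction.ActsAsScalarMod`, `DeuringGaloisAction.IsPrimaryComponent` it serves. Cell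
`bsd-print-cf2`, typer seat ty2 (g30). Contents (fact or component as HYPOTHESIS; 0 new facts):

* `ActsAsScalarMod.of_exists` — one admissible integer per level suffices (two integers `≡ a (mod 𝔭ᵏ)`
  differ by a multiple of `pᵏ` when `𝔭ᵏ ∩ ℤ = pᵏℤ`);
* `IsPrimaryComponent.ne_bot`; `IsPrimaryComponent.smul_eq_self_or_eq_neg_of_inertia` — inertia at
  `𝔮 ≠ 𝔭` acts on `E[𝔭^∞]` through `{±1}` when every unit of `𝓞 K` is `±1` (the PINNING CLAUSE of the BSD
  crux files `PrintCf2SplitBadTwoCMPrimaryLocalPinning.lean`); `….smul_eq_self_of_inertia_of_isUnramifiedAt`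
  — trivially at an unramified `𝔮`; `….exists_generator_actsAsScalarMod` — Frobenius at an unramified `𝔮 ≠ 𝔭`
  acts as a generator of `𝔮` modulo powers of `𝔭`;
* `Deuring_galoisAction_cmPrimaryTorsion_split.exists_component` — the fact unpacked.

References: [Rubin1999] §5 Prop. 5.4, Thm. 5.15, Cor. 5.16; [SilvermanATAEC1994] Ch. II Thm. 9.1–9.2,
Prop. 10.4.
-/

noncomputable section

open scoped Classical
open NumberField IsDedekindDomain WeierstrassCurve Field
open Literature.NumberTheory.Automorphic Literature.NumberTheory.GaloisRepresentations

namespace Literature.NumberTheory.EllipticCurves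

open DeuringGaloisAction

/-! ### Proved corollaries -/

namespace DeuringGaloisAction

variable {K : Type} [Field K] [NumberField K] {V : WeierstrassCurve K} {p : ℕ}

omit [NumberField K] in
/-- **One admissible integer suffices**: if `σ • x = N₀ • x` on `M[pᵏ]` for ONE `N₀ ≡ a (mod 𝔭ᵏ)` at
each level `k`, and `𝔭ᵏ ∩ ℤ = pᵏℤ` (i.e. `p ∈ 𝔭` of residue degree one; supplied as the hypothesis
`hdeg : ∀ k (n : ℤ), (n : 𝓞 K) ∈ 𝔭ᵏ → (p : ℤ)ᵏ ∣ n`), then `σ` acts as `a` modulo powers of `𝔭`: two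
admissible integers differ by a multiple of `pᵏ`, which kills `M[pᵏ]`. [cite: Rubin1999, §5 Prop. 5.4] -/
theorem ActsAsScalarMod.of_exists {𝔭 : HeightOneSpectrum (𝓞 K)} {M : AddSubgroup (V.geomPrimaryTorsion p)}
    {σ : absoluteGaloisGroup K} {a : 𝓞 K}
    (hdeg : ∀ (k : ℕ) (n : ℤ), (n : 𝓞 K) ∈ 𝔭.asIdeal ^ k → ((p : ℤ) ^ k) ∣ n)
    (h : ∀ k : ℕ, ∃ N₀ : ℤ, ((N₀ : 𝓞 K) - a) ∈ 𝔭.asIdeal ^ k ∧ ∀ x ∈ M, p ^ k • x = 0 → σ • x = N₀ • x) :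
    ActsAsScalarMod V p 𝔭 M σ a := by
  intro k N hN x hx hk
  obtain ⟨N₀, hN₀, h₀⟩ := h k
  rw [h₀ x hx hk]
  have hd : ((p : ℤ) ^ k) ∣ (N - N₀) := by
    refine hdeg k (N - N₀) ?_
    have := Ideal.sub_mem _ hN hN₀
    push_cast
    convert this using 1
    ring
  obtain ⟨m, hm⟩ := hd
  have hpk : ((p : ℤ) ^ k) • x = 0 := by
    rw [show ((p : ℤ) ^ k) = ((p ^ k : ℕ) : ℤ) by push_cast; rfl, natCast_zsmul, hk]
  have : (N - N₀) • x = 0 := by rw [hm, mul_comm, mul_zsmul, hpk, zsmul_zero]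
  rw [sub_smul, sub_eq_zero] at this
  exact this.symm

/-- A primary component is non-zero (it contains an element of order `p`). [cite: Rubin1999, §5 Prop. 5.4] -/
theorem IsPrimaryComponent.ne_bot [Fact p.Prime] {ψ : HeckeCharacter K} {𝔭 : HeightOneSpectrum (𝓞 K)}
    {M : AddSubgroup (V.geomPrimaryTorsion p)} (hM : IsPrimaryComponent V p ψ 𝔭 M) : M ≠ ⊥ := by
  obtain ⟨g, hg, hord, -⟩ := hM.exists_generator 1
  intro hbot
  rw [hbot, AddSubgroup.mem_bot] at hg
  rw [hg, addOrderOf_zero, pow_one] at hord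
  exact (Fact.out : p.Prime).one_lt.ne hord

/-- **Inertia at `𝔮 ≠ 𝔭` acts on `E[𝔭^∞]` through `{±1}` when every unit of `𝓞 K` is `±1`** (i.e.
`d_K < −4`; for `K = ℚ(√−7)` this is the pinning clause "inertia at `v` acts on `W[v̄^∞]` through `{±1}`"
of the BSD crux files): `σ • x = x` or `σ • x = −x` for every `x ∈ M`, uniformly in `x`.
[cite: Rubin1999, §5 Thm. 5.15 (i)–(ii)] -/
theorem IsPrimaryComponent.smul_eq_self_or_eq_neg_of_inertia {ψ : HeckeCharacter K}
    {𝔭 : HeightOneSpectrum (𝓞 K)} {M : AddSubgroup (V.geomPrimaryTorsion p)}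
    (hM : IsPrimaryComponent V p ψ 𝔭 M) (hunits : ∀ u : 𝓞 K, IsUnit u → u = 1 ∨ u = -1)
    {𝔮 : HeightOneSpectrum (𝓞 K)} (h𝔮 : 𝔮 ≠ 𝔭) {𝔔 : Ideal (absIntegers (𝓞 K) K)} (h𝔔 : 𝔔 ∈ 𝔮.primesAbove)
    {σ : absoluteGaloisGroup K} (hσ : σ ∈ 𝔔.inertia (absoluteGaloisGroup K)) :
    (∀ x ∈ M, σ • x = x) ∨ (∀ x ∈ M, σ • x = -x) := by
  obtain ⟨u, hu, -, hact⟩ := hM.inertia 𝔮 h𝔮 𝔔 h𝔔 σ hσ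
  have key : ∀ (s : ℤ), (u : 𝓞 K) = s → ∀ x ∈ M, σ • x = s • x := by
    intro s hs x hx
    obtain ⟨k, hk⟩ := (AddCommGroup.mem_primaryComponent).mp x.2
    have hxk : p ^ k • x = 0 :=
      Subtype.ext (by rw [AddSubmonoidClass.coe_nsmul, ZeroMemClass.coe_zero]; exact hk)
    exact hact k s (by rw [hs, sub_self]; exact Ideal.zero_mem _) x hx hxk
  rcases hunits u hu with h1 | h1
  · exact Or.inl fun x hx ↦ by rw [key 1 (by simp [h1]) x hx, one_zsmul]
  · exact Or.inr fun x hx ↦ by rw [key (-1) (by simp [h1]) x hx, neg_one_zsmul]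

/-- **Inertia at an UNRAMIFIED `𝔮 ≠ 𝔭` acts trivially on `E[𝔭^∞]`** (`ψ(U_𝔮) = 1`; for `𝔮 ∤ p` of good
reduction this is the criterion of Néron–Ogg–Shafarevich in the easy direction, for `𝔮 = 𝔭̄` of good
ordinary reduction the étaleness of `E[𝔭^∞]` at `𝔭̄`). [cite: Rubin1999, §5 Thm. 5.15 (ii)–(iii)] -/
theorem IsPrimaryComponent.smul_eq_self_of_inertia_of_isUnramifiedAt {ψ : HeckeCharacter K}
    {𝔭 : HeightOneSpectrum (𝓞 K)} {M : AddSubgroup (V.geomPrimaryTorsion p)}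
    (hM : IsPrimaryComponent V p ψ 𝔭 M) {𝔮 : HeightOneSpectrum (𝓞 K)} (h𝔮 : 𝔮 ≠ 𝔭)
    (hunr : ψ.IsUnramifiedAt 𝔮) {𝔔 : Ideal (absIntegers (𝓞 K) K)} (h𝔔 : 𝔔 ∈ 𝔮.primesAbove)
    {σ : absoluteGaloisGroup K} (hσ : σ ∈ 𝔔.inertia (absoluteGaloisGroup K)) :
    ∀ x ∈ M, σ • x = x := by
  obtain ⟨u, -, hu1, hact⟩ := hM.inertia 𝔮 h𝔮 𝔔 h𝔔 σ hσ
  intro x hx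
  obtain ⟨k, hk⟩ := (AddCommGroup.mem_primaryComponent).mp x.2
  have hxk : p ^ k • x = 0 :=
    Subtype.ext (by rw [AddSubmonoidClass.coe_nsmul, ZeroMemClass.coe_zero]; exact hk)
  have := hact k 1 (by rw [hu1 hunr, Int.cast_one, sub_self]; exact Ideal.zero_mem _) x hx hxk
  rwa [one_zsmul] at this

/-- **Frobenius at an unramified `𝔮 ≠ 𝔭` acts on `E[𝔭^∞]` by a scalar congruent to a GENERATOR of `𝔮`**
(Cor. 5.16 (i)–(ii) combined; the form used with `𝔮 ∤ p`: the scalar is a `𝔭`-adic unit iff `𝔮 ≠ 𝔭`,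
which holds). [cite: Rubin1999, §5 Cor. 5.16 (i)–(ii)] -/
theorem IsPrimaryComponent.exists_generator_actsAsScalarMod {ψ : HeckeCharacter K}
    {𝔭 : HeightOneSpectrum (𝓞 K)} {M : AddSubgroup (V.geomPrimaryTorsion p)}
    (hM : IsPrimaryComponent V p ψ 𝔭 M) {𝔮 : HeightOneSpectrum (𝓞 K)} (h𝔮 : 𝔮 ≠ 𝔭)
    (hunr : ψ.IsUnramifiedAt 𝔮) (w : InfinitePlace K) {𝔔 : Ideal (absIntegers (𝓞 K) K)}
    (h𝔔 : 𝔔 ∈ 𝔮.primesAbove) {σ : absoluteGaloisGroup K} (hσ : IsArithFrobAt (𝓞 K) σ 𝔔) :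
    ∃ a : 𝓞 K, w.embedding (a : K) = ψ.valueAtUniformizer 𝔮 ∧ Ideal.span {a} = 𝔮.asIdeal ∧
      ActsAsScalarMod V p 𝔭 M σ a := by
  obtain ⟨a, ha, hspan, hact⟩ := hM.frobenius 𝔮 h𝔮 hunr w
  exact ⟨a, ha, hspan, hact 𝔔 h𝔔 σ hσ⟩

end DeuringGaloisAction

namespace Deuring_galoisAction_cmPrimaryTorsion_split

/-- The fact applied at `(v̄, v)`: the roles of the two places are symmetric, so the component
`E[v̄^∞]` with ITS printed properties is available under either labelling. [cite: Rubin1999, §5 Thm. 5.15 (ii)] -/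
theorem exists_component (h : Deuring_galoisAction_cmPrimaryTorsion_split)
    (W : WeierstrassCurve ℚ) [W.IsElliptic] [W.IsGloballyMinimal] (hj : W.j ∈ maximalCMJInvariants)
    (K : Type) [Field K] [NumberField K] (hK : IsCMFieldOfJ K W.j) (c : K ≃ₐ[ℚ] K) (hc : c ≠ 1)
    (ψ : HeckeCharacter K) (hψ : ψ.HasInfinityType (fun _ ↦ 1) (fun _ ↦ 0))
    (heq : IsHeckeConjEquivariant c ψ) (hL : ∀ s : ℂ, 3 / 2 < s.re → heckeLFunction ψ s = W.LSeries s)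
    (p : ℕ) [Fact p.Prime] {v vbar : HeightOneSpectrum (𝓞 K)} (hv : ((p : ℕ) : 𝓞 K) ∈ v.asIdeal)
    (hvbar : ((p : ℕ) : 𝓞 K) ∈ vbar.asIdeal) (hne : vbar ≠ v) :
    ∃ Mv Mvbar : AddSubgroup ((W.baseChange K).geomPrimaryTorsion p),
      Mv ⊓ Mvbar = ⊥ ∧ Mv ⊔ Mvbar = ⊤ ∧
      IsPrimaryComponent (W.baseChange K) p ψ v Mv ∧ IsPrimaryComponent (W.baseChange K) p ψ vbar Mvbar := by
  obtain ⟨M, hinf, hsup, hv', hvbar'⟩ := h W hj K hK c hc ψ hψ heq hL p v vbar hv hvbar hne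
  exact ⟨M v, M vbar, hinf, hsup, hv', hvbar'⟩

end Deuring_galoisAction_cmPrimaryTorsion_split

end Literature.NumberTheory.EllipticCurves

end
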